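import Literature.Geometry.Riemannian.KernelGradientIntegralBound
import HarnessLib

/-!
# The base-point Fisher information of the heat kernel: `(t − s) ∫ |∇ₓK|²/K² dν ≤ m/2`
# (Bamler 2020a, Prop. 4.2, case `p = 2`, summed over an orthonormal frame)

R. Bamler, *Entropy and heat kernel bounds on a Ricci flow background*, arXiv:2008.07093 (2020a),
§4.1, Prop. 4.2 (arXiv v1: Prop. 15): for the conjugate heat kernel measure
`dν = ν_{x,t;s} = K(x,t;·,s) dg_s` of a Ricci flow on a closed `m`-manifold and `s < t`,

  `(t − s) ∫_M |∇ₓK(x,t;·,s)|² / K(x,t;·,s)² dν ≤ m/2`,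

the sum over a `g_t`-orthonormal basis `v = e₁, …, e_m` of `T_xM` of the directional bounds
`(t − s)∫(∂ᵥK/K)² dν ≤ 1/2` of the same proposition. This file PROVES the summed form from the
directional form already in the tree
(`IsRicciFlow.mul_integral_sq_deriv_heatKernelFn_div_le`, `KernelGradientIntegralBound.lean`):
at the base point `x` take a `g_t`-orthonormal frame `e₁, …, e_m`
(`exists_orthonormal_basis`) and the geodesics `γᵢ = γ_{eᵢ}` of `g_t` (geodesically complete,
`isGeodesicallyComplete_of_compactSpace`), smooth curves with `γᵢ(0) = x`, `γ̇ᵢ(0) = eᵢ`; the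
chain rule gives `∂_σ|₀ K(γᵢ(σ),t;y,s) = dₓK(eᵢ)` and `|∇ₓK|² = g_t⁻¹(dₓK, dₓK) = Σᵢ dₓK(eᵢ)²`
(`gradSq_eq_sum_sq_of_orthonormal`), so the integrand is the sum of the `m` directional
integrands, each of which is bounded measurable, and the `m` directional bounds add up.

* `mul_integral_gradSq_heatKernelFn_div_sq_le` — the bound above (self-model `𝓘(ℝ, ℝᵐ)`);
* `gradSq_eq_sum_sq_of_orthonormal` — `|∇F|²_g(x) = Σᵢ dF(eᵢ)²` in a `g_x`-orthonormal frame;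
* `deriv_comp_curve_zero_eq_mvfderiv`, `val_velocity_eq_of_eq` — transport of the chain rule
  and of `g(γ̇(0), γ̇(0))` along `γ(0) = x`, `γ̇(0) = v`.

It is the input of `□𝒩* ≤ 0`-type estimates for the pointed Nash entropy (Bamler 2020a,
Thm. 5.9). What is NOT here: the case `p ≠ 2` of Prop. 4.2 and its localised form on subsets.

## References

* R. H. Bamler, *Entropy and heat kernel bounds on a Ricci flow background*, arXiv:2008.07093
  (2020), §4.1 Prop. 4.2 (arXiv v1 Prop. 15), §4.3. [Bamler2020Entropy]
-/

noncomputable section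

open Set Filter Function MeasureTheory Measure
open scoped Manifold ContDiff Topology ENNReal NNReal

namespace Literature.Geometry.Riemannian

open Lorentzian Lorentzian.PseudoRiemannianMetric

/-! ### Frames and curves: two transport lemmas and `|∇F|² = Σᵢ dF(eᵢ)²` -/

section Curve

variable {E : Type*} [NormedAddCommGroup E] [NormedSpace ℝ E]
  {H : Type*} [TopologicalSpace H] {I : ModelWithCorners ℝ E H}
  {M : Type*} [TopologicalSpace M] [ChartedSpace H M] [IsManifold I ∞ M] {n : ℕ∞ω}

/-- Transport of `g(γ̇(0), γ̇(0))` along `γ(0) = x`, `γ̇(0) = v`: it is `g_x(v, v)`. [folklore] -/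
theorem val_velocity_eq_of_eq (g : PseudoRiemannianMetric I n E (TangentSpace I : M → Type _))
    {γ : ℝ → M} {x : M} {v : TangentSpace I x} (hx : γ 0 = x) (hv : velocity I γ 0 = v) :
    g.val (γ 0) (velocity I γ 0) (velocity I γ 0) = g.val x v v := by
  subst hx; subst hv; rfl

omit [IsManifold I ∞ M] in
/-- **Chain rule at `σ = 0` along a curve through `(x, v)`**: for `F` differentiable at `x` and
`γ` differentiable at `0` with `γ(0) = x`, `γ̇(0) = v`, `(F ∘ γ)'(0) = dF_x(v)`
(`hasDerivAt_comp_curve_mvfderiv`, transported along the two equations). [folklore] -/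
theorem deriv_comp_curve_zero_eq_mvfderiv {γ : ℝ → M} {x : M} {v : TangentSpace I x}
    (hx : γ 0 = x) (hv : velocity I γ 0 = v) {F : M → ℝ}
    (hF : MDifferentiableAt I 𝓘(ℝ, ℝ) F x) (hγ : MDifferentiableAt 𝓘(ℝ, ℝ) I γ 0) :
    deriv (fun σ ↦ F (γ σ)) 0 = mvfderiv I F x v := by
  subst hx; subst hv
  exact (hasDerivAt_comp_curve_mvfderiv hF hγ).deriv

variable [FiniteDimensional ℝ E]

/-- **The gradient square in an orthonormal frame**: `|∇F|²_g(x) = g_x⁻¹(dF, dF) = Σᵢ dF_x(eᵢ)²`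
for a `g_x`-orthonormal family `e` with `card ι = dim M` (`♯dF = Σᵢ dF(eᵢ) eᵢ`,
`eq_sum_bilin_smul_of_orthonormal`). [cite: ONeill1983, Ch. 3, pp. 60–61] -/
theorem gradSq_eq_sum_sq_of_orthonormal {ι : Type*} [Fintype ι] [DecidableEq ι]
    (g : PseudoRiemannianMetric I n E (TangentSpace I : M → Type _)) (x : M)
    {e : ι → TangentSpace I x} (hon : ∀ i j, g.val x (e i) (e j) = if i = j then 1 else 0)
    (hcard : Fintype.card ι = Module.finrank ℝ E) (F : M → ℝ) :
    g.gradSq F x = ∑ i, (mvfderiv I F x (e i)) ^ 2 := by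
  set α : Module.Dual ℝ (TangentSpace I x) := (mvfderiv I F x : TangentSpace I x →ₗ[ℝ] ℝ)
    with hα
  have hexp : g.sharp x α = ∑ i, α (e i) • e i := by
    refine (eq_sum_bilin_smul_of_orthonormal (V := E) (g.val x) hon hcard (g.sharp x α)).trans
      (Finset.sum_congr rfl fun i _ ↦ ?_)
    exact congrArg (· • e i) (g.val_sharp_apply x α (e i))
  show α (g.sharp x α) = _
  rw [hexp, _root_.map_sum]
  refine Finset.sum_congr rfl fun i _ ↦ ?_
  rw [map_smul, smul_eq_mul, sq]
  rfl

end Curve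

/-! ### Prop. 4.2 for `p = 2`, summed over an orthonormal frame -/

section Fisher

variable {m : ℕ} {M : Type*} [TopologicalSpace M] [ChartedSpace (EuclideanSpace ℝ (Fin m)) M]
  [IsManifold 𝓘(ℝ, EuclideanSpace ℝ (Fin m)) ∞ M] [T2Space M] [CompactSpace M]
  [SecondCountableTopology M] [MeasurableSpace M] [BorelSpace M] [ConnectedSpace M]
  {h : ℝ → PseudoRiemannianMetric 𝓘(ℝ, EuclideanSpace ℝ (Fin m)) ∞ (EuclideanSpace ℝ (Fin m))
    (TangentSpace 𝓘(ℝ, EuclideanSpace ℝ (Fin m)) : M → Type _)}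
  {cov : ℝ → CovariantDerivative 𝓘(ℝ, EuclideanSpace ℝ (Fin m)) (EuclideanSpace ℝ (Fin m))
    (TangentSpace 𝓘(ℝ, EuclideanSpace ℝ (Fin m)) : M → Type _)}
  {a T : ℝ} (hflow : IsRicciFlow h cov (Icc a T)) (hh : IsContMDiffFamilyOn ∞ h univ)
  (hR : ∀ r, (h r).IsRiemannian)

/-- **Bamler 2020a, Prop. 4.2, case `p = 2`, summed form (base-point Fisher information of the
heat kernel).** Let `hflow = (h, cov)` be a Ricci flow on `[a, T]` of a `C^∞` family of Riemannian
metrics on a closed connected manifold `M` modelled on `ℝᵐ`, `a < s < t < T`, `K = K(x,t;y,s)` its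
heat kernel and `ν = ν_{x,t;s} = K(x,t;·,s) dg_s`. Then

  `(t − s) ∫_M |∇ₓ K(·,t;y,s)|²_{g_t}(x) / K(x,t;y,s)² dν(y) ≤ m/2`.

Proof: in a `g_t`-orthonormal frame `eᵢ` at `x` with geodesics `γᵢ = γ_{eᵢ}`,
`|∇ₓK|²/K² = Σᵢ (∂_σ|₀K(γᵢ(σ),t;y,s)/K)²` (`gradSq_eq_sum_sq_of_orthonormal`, chain rule), and each
of the `m` terms has `(t − s)∫ … dν ≤ 1/2`
(`IsRicciFlow.mul_integral_sq_deriv_heatKernelFn_div_le`).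
[cite: Bamler2020Entropy, §4.1, Prop. 4.2 (arXiv v1 Prop. 15), case p = 2, summed form] -/
theorem mul_integral_gradSq_heatKernelFn_div_sq_le {s t : ℝ} (has : a < s) (hst : s < t)
    (htT : t < T) (x : M) :
    (t - s) * ∫ y, (h t).gradSq (fun x' ↦ hflow.heatKernelFn hh hR t x' (y, s)) x /
        hflow.heatKernelFn hh hR t x (y, s) ^ 2 ∂(heatKernelMeasure hh hR t x s) ≤ (m : ℝ) / 2 := by
  classical
  have ht : t ∈ Ioc a T := ⟨has.trans hst, htT.le⟩
  have hs : s ∈ Ioo a t := ⟨has, hst⟩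
  -- the slice metric `g = h t`: Levi-Civita connection, smooth and geodesically complete
  set g := h t with hg_def
  haveI : Fact ((1 : ℕ∞ω) ≤ (∞ : ℕ∞ω)) := ⟨by exact_mod_cast le_top⟩
  have h2 : (2 : ℕ∞ω) ≤ (∞ : ℕ∞ω) := WithTop.coe_le_coe.mpr le_top
  haveI := g.hasLeviCivita
  haveI : CovariantDerivative.ContMDiffCovariantDerivative g.leviCivita 1 :=
    contMDiffCovariantDerivative_leviCivita_of_two_le g h2
  haveI : CovariantDerivative.ContMDiffCovariantDerivative g.leviCivita ((⊤ : ℕ∞) : ℕ∞ω) :=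
    contMDiffCovariantDerivative_leviCivita_infty g le_rfl
  have hc : IsGeodesicallyComplete g.leviCivita :=
    isGeodesicallyComplete_of_compactSpace g h2 (hR t)
  -- an orthonormal frame `b` at `x` and the geodesics `γ i = γ_{b i}`
  obtain ⟨b, hb⟩ := g.exists_orthonormal_basis x (hR t)
  have hfr : Module.finrank ℝ (TangentSpace 𝓘(ℝ, EuclideanSpace ℝ (Fin m)) x) = m :=
    finrank_euclideanSpace_fin
  set γ : Fin (Module.finrank ℝ (TangentSpace 𝓘(ℝ, EuclideanSpace ℝ (Fin m)) x)) → ℝ → M :=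
    fun i ↦ maximalGeodesic g.leviCivita x (b i) with hγ_def
  have hγs : ∀ i, ContMDiff 𝓘(ℝ, ℝ) 𝓘(ℝ, EuclideanSpace ℝ (Fin m)) ∞ (γ i) := fun i ↦ by
    have := (contMDiff_maximalGeodesic_family hc x).comp
      (contMDiff_id.prodMk (contMDiff_const (c := (show EuclideanSpace ℝ (Fin m) from b i))))
    exact this
  have hγ0 : ∀ i, γ i 0 = x := fun i ↦
    (maximalGeodesic_of_isGeodesicallyComplete hc x (b i)).2.2.1
  have hγv : ∀ i, velocity 𝓘(ℝ, EuclideanSpace ℝ (Fin m)) (γ i) 0 = b i := fun i ↦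
    (maximalGeodesic_of_isGeodesicallyComplete hc x (b i)).2.2.2
  have h1 : ∀ i, g.val (γ i 0) (velocity 𝓘(ℝ, EuclideanSpace ℝ (Fin m)) (γ i) 0)
      (velocity 𝓘(ℝ, EuclideanSpace ℝ (Fin m)) (γ i) 0) ≤ 1 := fun i ↦ by
    rw [val_velocity_eq_of_eq g (hγ0 i) (hγv i), hb i i, if_pos rfl]
  -- notation: the kernel `K₀ = K(x,t;·,s)`, the directional derivatives `D i`, the measure `ν`
  set ν : Measure M := heatKernelMeasure hh hR t x s with hν
  haveI : IsProbabilityMeasure ν := by rw [hν]; infer_instance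
  set K₀ : M → ℝ := fun y ↦ hflow.heatKernelFn hh hR t x (y, s) with hK₀
  set D : Fin (Module.finrank ℝ (TangentSpace 𝓘(ℝ, EuclideanSpace ℝ (Fin m)) x)) → M → ℝ :=
    fun i y ↦ deriv (fun σ ↦ hflow.heatKernelFn hh hR t (γ i σ) (y, s)) 0 with hD
  -- the directional bounds (Prop. 4.2, `p = 2`, directional form), transported to `x = γ i 0`
  have hdir : ∀ i, (t - s) * ∫ y, (D i y / K₀ y) ^ 2 ∂ν ≤ 1 / 2 := by
    intro i
    have := hflow.mul_integral_sq_deriv_heatKernelFn_div_le hh hR has hst htT (hγs i) (h1 i)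
    rw [hγ0 i] at this
    exact this
  -- positivity and a positive lower bound of `K₀`
  have hK₀c : Continuous K₀ := hflow.continuous_heatKernelFn_slice hh hR ht x hs
  have hK₀pos : ∀ y, 0 < K₀ y := fun y ↦ hflow.heatKernelFn_pos hh hR ht x ⟨mem_univ _, hs⟩
  obtain ⟨k₀, hk₀pos, hk₀⟩ : ∃ k₀ : ℝ, 0 < k₀ ∧ ∀ y, k₀ ≤ K₀ y := by
    obtain ⟨y₀, -, hy₀⟩ := isCompact_univ.exists_isMinOn ⟨x, mem_univ x⟩ hK₀c.continuousOn
    exact ⟨K₀ y₀, hK₀pos y₀, fun y ↦ hy₀ (mem_univ y)⟩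
  -- each directional integrand `(D i / K₀)²` is bounded and measurable, hence integrable
  have hint : ∀ i, Integrable (fun y ↦ (D i y / K₀ y) ^ 2) ν := by
    intro i
    have hDm : Measurable (D i) :=
      hflow.measurable_deriv_heatKernelFn_curve hh hR has hst htT (hγs i)
    obtain ⟨B, hB⟩ := hflow.exists_abs_deriv_heatKernelFn_curve_le hh hR has hst htT (hγs i)
    have hB0 : 0 ≤ B := (abs_nonneg _).trans (hB x)
    have hq : ∀ y, |D i y / K₀ y| ≤ B / k₀ := fun y ↦ by
      rw [abs_div, abs_of_pos (hK₀pos y)]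
      exact div_le_div₀ hB0 (hB y) hk₀pos (hk₀ y)
    refine Integrable.of_bound ((hDm.div hK₀c.measurable).pow_const 2).aestronglyMeasurable
      ((B / k₀) ^ 2) (ae_of_all _ fun y ↦ ?_)
    rw [Real.norm_eq_abs, abs_pow]
    exact pow_le_pow_left₀ (abs_nonneg _) (hq y) 2
  -- the chain rule: `D i y = dₓK(·,t;y,s)(b i)`
  have hFd : ∀ y, MDifferentiableAt 𝓘(ℝ, EuclideanSpace ℝ (Fin m)) 𝓘(ℝ, ℝ)
      (fun x' ↦ hflow.heatKernelFn hh hR t x' (y, s)) x := by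
    intro y
    have hK := hflow.contMDiffOn_heatKernelFn_basePoint hh hR (s := s) ⟨has, hst.trans htT⟩ y
    have hι : ContMDiff 𝓘(ℝ, EuclideanSpace ℝ (Fin m))
        ((𝓘(ℝ, EuclideanSpace ℝ (Fin m))).prod 𝓘(ℝ, ℝ)) ∞ fun x' : M ↦ (x', t) :=
      contMDiff_id.prodMk contMDiff_const
    have hcomp := hK.comp_contMDiff hι fun x' ↦ ⟨mem_univ _, hst, htT⟩
    exact hcomp.mdifferentiableAt (by simp)
  have hDeq : ∀ i y, D i y = mvfderiv 𝓘(ℝ, EuclideanSpace ℝ (Fin m))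
      (fun x' ↦ hflow.heatKernelFn hh hR t x' (y, s)) x (b i) := fun i y ↦
    deriv_comp_curve_zero_eq_mvfderiv (hγ0 i) (hγv i) (hFd y)
      ((hγs i).mdifferentiableAt (by simp))
  -- the pointwise identity `|∇ₓK|²/K₀² = Σᵢ (D i / K₀)²`
  have hpt : ∀ y, g.gradSq (fun x' ↦ hflow.heatKernelFn hh hR t x' (y, s)) x / K₀ y ^ 2 =
      ∑ i, (D i y / K₀ y) ^ 2 := by
    intro y
    rw [gradSq_eq_sum_sq_of_orthonormal g x hb (Fintype.card_fin _), Finset.sum_div]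
    refine Finset.sum_congr rfl fun i _ ↦ ?_
    rw [hDeq i y, div_pow]
  -- sum the `m` directional bounds
  have hsum : ∑ _i : Fin (Module.finrank ℝ (TangentSpace 𝓘(ℝ, EuclideanSpace ℝ (Fin m)) x)),
      (1 / 2 : ℝ) = (m : ℝ) / 2 := by
    rw [Finset.sum_const, Finset.card_univ, Fintype.card_fin, hfr, nsmul_eq_mul]
    ring
  calc (t - s) * ∫ y, g.gradSq (fun x' ↦ hflow.heatKernelFn hh hR t x' (y, s)) x / K₀ y ^ 2 ∂ν
      = (t - s) * ∫ y, ∑ i, (D i y / K₀ y) ^ 2 ∂ν := by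
        rw [integral_congr_ae (Eventually.of_forall hpt)]
    _ = ∑ i, (t - s) * ∫ y, (D i y / K₀ y) ^ 2 ∂ν := by
        rw [integral_finsetSum _ fun i _ ↦ hint i, Finset.mul_sum]
    _ ≤ ∑ _i, (1 / 2 : ℝ) := Finset.sum_le_sum fun i _ ↦ hdir i
    _ = (m : ℝ) / 2 := hsum

end Fisher

end Literature.Geometry.Riemannian

end
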